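import Literature.Computability.Cryptography.LCSFacts
import HarnessLib

/-!
# Alignments, the generic edit distance and the subsequence distance
(Crochemore–Hancart–Lecroq 2007, §§7.1–7.3)

Source: M. Crochemore, C. Hancart, T. Lecroq, *Algorithms on Strings*, Cambridge University
Press 2007 (bib key `CrochemoreHancartLecroq2007`), Chapter 7 "Alignments": §7.1 "Comparison of
strings" (edit operations, elementary costs `Sub`, `Del`, `Ins`, the edit distance `Lev`,
Proposition 7.1, alignments and their cost), §7.2 "Optimal alignment" (the table
`T[i, j] = Lev(x[0..i], y[0..j])`, Proposition 7.3, Lemma 7.4, Corollary 7.5, the traceback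
algorithm One-alignment and Proposition 7.8) and §7.3 "Longest common subsequence"
(the subsequence distance `d_subs` and Proposition 7.11 `d_subs(x, y) = |x| + |y| - 2·lcs(x, y)`),
together with the original source of this material, R. A. Wagner, M. J. Fischer, *The string-to-string
correction problem*, J. ACM 21 (1974) 168–173 (bib key `WagnerFischer1974`): §2 (an arbitrary cost
function `γ` on the edit operations `a → b`, `a → Λ`, `Λ → b`; the standing assumption
`γ(a → a) = 0`, `γ(a → b) + γ(b → c) ≥ γ(a → c)` with `a, b, c` ranging over `A ∪ {Λ}`), §3 (traces =
alignments up to order; Lemma 1; Theorem 1 `δ(A, B) = min {cost(T) | T a trace from A to B}`),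
Theorems 2–3 and Algorithm X (the recurrence), Algorithm Y and Theorem 4 (the traceback yields a least
cost trace), §5 (longest common subsequences: with costs `1, 1, 0, 2`, `δ(A, B) = |A| + |B| - 2ρ(A, B)`).

## Dictionary

* A string over `A` is a `List α`.  Elementary costs are bundled in `EditCosts α`
  (`sub a b`, `del a`, `ins b`, natural numbers; the book: "a cost (having a positive integer
  value) is associated with each of the operations").
* An *aligned pair* (book: a letter of `(A ∪ {ε}) × (A ∪ {ε}) ∖ {(ε, ε)}`) is an element of the
  inductive type `AlignedPair α` with the three constructors `subst a b` = `(a, b)`,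
  `delete a` = `(a, ε)` and `insert b` = `(ε, b)`; its cost `AlignedPair.cost` is
  `Sub(a, b)`, `Del(a)`, `Ins(b)` respectively (§7.1, "We define the cost of an aligned pair by …").
* An *alignment* is a list of aligned pairs; `projLeft` / `projRight` are the projections on the
  first / second component (holes dropped) and `IsAlignmentOf z x y` says that `z` is an alignment
  between `x` and `y` ("whose projection on the first component is `x` and the projection on the
  second component is `y`").  `alignmentCost C z` is the sum of the costs of its pairs.
* `lev C x y` is the value computed by the recurrence of Proposition 7.3 / Lemma 7.4 (algorithm
  Generic-DP).  The book states the recurrence on the LAST letters (`Lev(ua, vb) = min …`); as for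
  the tree's unit-cost `editDist` (`Literature.Computability.Cryptography.SequenceProblems`) our
  recursion peels the FIRST letters, and the last-letter form is recovered from the invariance of
  `lev` under reversal (`lev_reverse`, `lev_concat_concat`).

## What is recorded

1. `lev` **is the minimum cost of the alignments** between `x` and `y`: every alignment costs at
   least `lev C x y` (`lev_le_alignmentCost`) and the traceback `oneAlignment` (the book's
   algorithm One-alignment, run forwards) is an alignment of cost exactly `lev C x y`
   (`isAlignmentOf_oneAlignment`, `alignmentCost_oneAlignment`, Proposition 7.8); together
   `isLeast_lev`.  In the book `Lev` is *defined* as a minimum (over sequences of edit operations,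
   represented by alignments, §7.1) and Proposition 7.3 / Lemma 7.4 / Corollary 7.5 say that the
   recurrence computes it; here the recurrence is the definition and the minimum property is the
   theorem — the mathematical content is the same equality.
2. Lemma 7.4 in the book's last-letter form (`lev_concat_nil`, `lev_nil_concat`,
   `lev_concat_concat`) and `lev_reverse`.
3. Proposition 7.1, direction `⇐` ("Lev is a distance on `A*` if Sub is a distance on `A` and
   `Del(a) = Ins(a) > 0`"): `lev_self`, `lev_eq_zero_iff`, `lev_comm`, `lev_triangle`, packaged as
   `EditCosts.IsMetric.lev_*`.  **Caveat, recorded rather than hidden.**  For the alignment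
   distance the triangle inequality needs, besides the triangle inequality of `Sub` on letters, the
   compatibility `Del(a) ≤ Sub(a, b) + Del(b)` between gap and substitution costs — the instances
   `γ(a → Λ) ≤ γ(a → b) + γ(b → Λ)` (and, by symmetry, `γ(Λ → c) ≤ γ(Λ → a) + γ(a → c)`) of
   Wagner–Fischer's standing assumption, which quantifies the triangle inequality over `A ∪ {Λ}` and
   under which their Lemma 1 (composition of traces) gives the triangle inequality.  It is automatic
   when the gap cost is a constant (`EditCosts.IsMetric.ofGap`, the situation of all the book's
   examples), but the book's Proposition 7.1 asks the triangle inequality of `Sub` on `A` only, and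
   then the literal statement fails: with `A = {ff, tt}`, `Sub(ff, tt) = 1`, `Del = Ins = 1` on `ff`
   and `= 3` on `tt` one has `Lev(ε, tt) = 3 > Lev(ε, ff) + Lev(ff, tt) = 2` (the `example` after
   `lev_triangle`, by `decide`; here `γ(tt → Λ) = 3 > γ(tt → ff) + γ(ff → Λ) = 2`).  We therefore type
   Proposition 7.1 (⇐) with this hypothesis (`EditCosts.IsMetric.del_le`).  The triangle inequality
   itself is proved along the recursion, not by composing traces.  Of the direction `⇒` we record the
   values on
   letters it rests on (`lev_singleton_nil`, `lev_nil_singleton`, `lev_singleton_singleton`; note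
   `Lev(a, b) = min {Sub(a, b), Del(a) + Ins(b)}`, which is `Sub(a, b)` under the book's standing
   assumptions only when `Sub(a, b) ≤ Del(a) + Ins(b)`).
4. Unit costs (`Sub(a, b) = [a ≠ b]`, `Del = Ins = 1`, the costs of Figures 7.1, 7.2 and 7.8):
   `lev unitCosts = editDist` (`lev_unitCosts`), hence the tree's `editDist` is the minimum number
   of non-matching pairs of an alignment (`isLeast_editDist`), and the book's example
   `Lev(ACGA, ATGCTA) = 3` with the optimal alignment of Figure 7.2 (by `decide`).
5. §7.3, Proposition 7.11: with `Sub(a, a) = 0`, `Del = Ins = 1` and `Sub(a, b) ≥ 2` for `a ≠ b`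
   (the book assumes `> 2`; `≥ 2` suffices and is what we type) the distance is the subsequence
   distance: `lev C x y + 2·lcsLength x y = |x| + |y|` (`lev_add_two_mul_lcsLength`), i.e.
   `lev C x y = dLCS x y` (`lev_eq_dLCS`) over the tree's `lcsLength` / `dLCS`
   (`Literature.Computability.Cryptography.LCSFacts`; Bringmann–Künnemann's remark that `δ_LCS`
   "is equivalent to EDIT(1,1,0,2)": `indelCosts`, `lev_indelCosts`, and `isLeast_dLCS` = `dLCS` is
   the minimum indel cost over all alignments).  Consequences: `editDist ≤ dLCS ≤ 2·editDist`
   (`editDist_le_dLCS`, `dLCS_le_two_mul_editDist`) from the monotonicity of `lev` in the costs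
   (`lev_mono`, `lev_le_mul_lev`).

Not to be confused with `Literature.Computability.FineGrained.BKGadget.IsAlignment`
(Bringmann–Künnemann's alignments between two SEQUENCES of strings: increasing lists of index
pairs, FOCS 2015 §3), a different, coarse-grained object that is not used here.

Not formalised: Proposition 7.2 (counting alignments), the edit graph and the dotplot as such,
Proposition 7.6 (running time `O(m × n)` / space `O(min{m, n})`), Lemma 7.7 (active arcs) and the
algorithms Alignments / Opt-align-aut (Proposition 7.9, 7.10), §7.3's algorithms beyond
Proposition 7.11 (LCS-simple = the tree's `lcsLength` recursion, Hirschberg's linear-space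
LCS = `exists_split_lcsLength_append_right` in `LCSFacts`), §7.4–7.6 (gaps, local alignment,
heuristics).

This formalisation is AI-produced; statements carry `[cite: …]` tags pointing at the book and at
Wagner–Fischer 1974 (computation rules cite the definition they unfold, one-line consequences cite
the result they follow from and say so); private helper lemmas are marked `[folklore]`.
-/

namespace Literature.Computability.StringMatching

open Literature.Computability.Cryptography

variable {α : Type*}

/-! ### Elementary costs, aligned pairs, alignments (§7.1) -/

/-- **Elementary costs** of the edit operations: `sub a b` = `Sub(a, b)` the cost of substituting
`b` for `a`, `del a` = `Del(a)` the cost of deleting `a`, `ins b` = `Ins(b)` the cost of inserting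
`b` (natural numbers, independent of the position).
[cite: CrochemoreHancartLecroq2007, §7.1 Edit operations (Sub, Del, Ins); WagnerFischer1974, §2 (an arbitrary cost function γ on the edit operations a → b, a → Λ, Λ → b)] -/
structure EditCosts (α : Type*) where
  /-- `Sub(a, b)`: cost of the substitution of `b` for `a`. -/
  sub : α → α → ℕ
  /-- `Del(a)`: cost of the deletion of `a`. -/
  del : α → ℕ
  /-- `Ins(b)`: cost of the insertion of `b`. -/
  ins : α → ℕ

/-- An **aligned pair**: `subst a b` is the pair `(a, b)` (substitution of `b` for `a`),
`delete a` is `(a, ε)` (deletion of `a`), `insert b` is `(ε, b)` (insertion of `b`); the pair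
`(ε, ε)` is excluded by construction.
[cite: CrochemoreHancartLecroq2007, §7.1 Alignments (aligned pairs); WagnerFischer1974, §3 (traces: lines (i, j), untouched positions of A = deletions, of B = insertions)] -/
inductive AlignedPair (α : Type*)
  | subst (a b : α)
  | delete (a : α)
  | insert (b : α)
  deriving DecidableEq, Repr

namespace AlignedPair

/-- First component of an aligned pair (`none` = the hole `ε`).
[cite: CrochemoreHancartLecroq2007, §7.1 Alignments (projection on the first component)] -/
def left : AlignedPair α → Option α
  | subst a _ => some a
  | delete a => some a
  | insert _ => none

/-- Second component of an aligned pair (`none` = the hole `ε`).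
[cite: CrochemoreHancartLecroq2007, §7.1 Alignments (projection on the second component)] -/
def right : AlignedPair α → Option α
  | subst _ b => some b
  | delete _ => none
  | insert b => some b

/-- **Cost of an aligned pair**: `cost(a, b) = Sub(a, b)`, `cost(a, ε) = Del(a)`,
`cost(ε, b) = Ins(b)`. [cite: CrochemoreHancartLecroq2007, §7.1 Alignments (cost of an aligned pair)] -/
def cost (C : EditCosts α) : AlignedPair α → ℕ
  | subst a b => C.sub a b
  | delete a => C.del a
  | insert b => C.ins b

/-- Computation rule (`left_subst`): the definition, unfolded. [cite: CrochemoreHancartLecroq2007, §7.1 Alignments (definition of aligned pairs, projections, cost)] -/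
@[simp] theorem left_subst (a b : α) : (subst a b).left = some a := rfl
/-- Computation rule (`left_delete`): the definition, unfolded. [cite: CrochemoreHancartLecroq2007, §7.1 Alignments (definition of aligned pairs, projections, cost)] -/
@[simp] theorem left_delete (a : α) : (delete a : AlignedPair α).left = some a := rfl
/-- Computation rule (`left_insert`): the definition, unfolded. [cite: CrochemoreHancartLecroq2007, §7.1 Alignments (definition of aligned pairs, projections, cost)] -/
@[simp] theorem left_insert (b : α) : (insert b : AlignedPair α).left = none := rfl
/-- Computation rule (`right_subst`): the definition, unfolded. [cite: CrochemoreHancartLecroq2007, §7.1 Alignments (definition of aligned pairs, projections, cost)] -/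
@[simp] theorem right_subst (a b : α) : (subst a b).right = some b := rfl
/-- Computation rule (`right_delete`): the definition, unfolded. [cite: CrochemoreHancartLecroq2007, §7.1 Alignments (definition of aligned pairs, projections, cost)] -/
@[simp] theorem right_delete (a : α) : (delete a : AlignedPair α).right = none := rfl
/-- Computation rule (`right_insert`): the definition, unfolded. [cite: CrochemoreHancartLecroq2007, §7.1 Alignments (definition of aligned pairs, projections, cost)] -/
@[simp] theorem right_insert (b : α) : (insert b : AlignedPair α).right = some b := rfl
/-- Computation rule (`cost_subst`): the definition, unfolded. [cite: CrochemoreHancartLecroq2007, §7.1 Alignments (definition of aligned pairs, projections, cost)] -/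
@[simp] theorem cost_subst (C : EditCosts α) (a b : α) : (subst a b).cost C = C.sub a b := rfl
/-- Computation rule (`cost_delete`): the definition, unfolded. [cite: CrochemoreHancartLecroq2007, §7.1 Alignments (definition of aligned pairs, projections, cost)] -/
@[simp] theorem cost_delete (C : EditCosts α) (a : α) : (delete a : AlignedPair α).cost C = C.del a := rfl
/-- Computation rule (`cost_insert`): the definition, unfolded. [cite: CrochemoreHancartLecroq2007, §7.1 Alignments (definition of aligned pairs, projections, cost)] -/
@[simp] theorem cost_insert (C : EditCosts α) (b : α) : (insert b : AlignedPair α).cost C = C.ins b := rfl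

end AlignedPair

/-- Projection of a list of aligned pairs on the first component (holes dropped).
[cite: CrochemoreHancartLecroq2007, §7.1 Alignments (projection on the first component)] -/
def projLeft (z : List (AlignedPair α)) : List α := z.filterMap AlignedPair.left

/-- Projection of a list of aligned pairs on the second component (holes dropped).
[cite: CrochemoreHancartLecroq2007, §7.1 Alignments (projection on the second component)] -/
def projRight (z : List (AlignedPair α)) : List α := z.filterMap AlignedPair.right

/-- **Cost of an alignment**: the sum of the costs of its aligned pairs.
[cite: CrochemoreHancartLecroq2007, §7.1 Alignments (cost of an alignment)] -/
def alignmentCost (C : EditCosts α) (z : List (AlignedPair α)) : ℕ := (z.map (AlignedPair.cost C)).sum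

/-- `z` is an **alignment between `x` and `y`**: a string of aligned pairs whose projection on the
first component is `x` and whose projection on the second component is `y`.
[cite: CrochemoreHancartLecroq2007, §7.1 Alignments (definition)] -/
def IsAlignmentOf (z : List (AlignedPair α)) (x y : List α) : Prop := projLeft z = x ∧ projRight z = y

/-- Being an alignment between given strings is decidable (used by the `decide` examples). [folklore] -/
instance [DecidableEq α] (z : List (AlignedPair α)) (x y : List α) : Decidable (IsAlignmentOf z x y) :=
  inferInstanceAs (Decidable (_ ∧ _))

/-- Computation rule (`projLeft_nil`): the definition, unfolded. [cite: CrochemoreHancartLecroq2007, §7.1 Alignments (definition of aligned pairs, projections, cost)] -/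
@[simp] theorem projLeft_nil : projLeft ([] : List (AlignedPair α)) = [] := rfl
/-- Computation rule (`projRight_nil`): the definition, unfolded. [cite: CrochemoreHancartLecroq2007, §7.1 Alignments (definition of aligned pairs, projections, cost)] -/
@[simp] theorem projRight_nil : projRight ([] : List (AlignedPair α)) = [] := rfl
/-- Computation rule (`projLeft_cons_subst`): the definition, unfolded. [cite: CrochemoreHancartLecroq2007, §7.1 Alignments (definition of aligned pairs, projections, cost)] -/
@[simp] theorem projLeft_cons_subst (a b : α) (z : List (AlignedPair α)) :
    projLeft (.subst a b :: z) = a :: projLeft z := rfl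
/-- Computation rule (`projLeft_cons_delete`): the definition, unfolded. [cite: CrochemoreHancartLecroq2007, §7.1 Alignments (definition of aligned pairs, projections, cost)] -/
@[simp] theorem projLeft_cons_delete (a : α) (z : List (AlignedPair α)) :
    projLeft (.delete a :: z) = a :: projLeft z := rfl
/-- Computation rule (`projLeft_cons_insert`): the definition, unfolded. [cite: CrochemoreHancartLecroq2007, §7.1 Alignments (definition of aligned pairs, projections, cost)] -/
@[simp] theorem projLeft_cons_insert (b : α) (z : List (AlignedPair α)) :
    projLeft (.insert b :: z) = projLeft z := rfl
/-- Computation rule (`projRight_cons_subst`): the definition, unfolded. [cite: CrochemoreHancartLecroq2007, §7.1 Alignments (definition of aligned pairs, projections, cost)] -/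
@[simp] theorem projRight_cons_subst (a b : α) (z : List (AlignedPair α)) :
    projRight (.subst a b :: z) = b :: projRight z := rfl
/-- Computation rule (`projRight_cons_delete`): the definition, unfolded. [cite: CrochemoreHancartLecroq2007, §7.1 Alignments (definition of aligned pairs, projections, cost)] -/
@[simp] theorem projRight_cons_delete (a : α) (z : List (AlignedPair α)) :
    projRight (.delete a :: z) = projRight z := rfl
/-- Computation rule (`projRight_cons_insert`): the definition, unfolded. [cite: CrochemoreHancartLecroq2007, §7.1 Alignments (definition of aligned pairs, projections, cost)] -/
@[simp] theorem projRight_cons_insert (b : α) (z : List (AlignedPair α)) :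
    projRight (.insert b :: z) = b :: projRight z := rfl
/-- Computation rule (`alignmentCost_nil`): the definition, unfolded. [cite: CrochemoreHancartLecroq2007, §7.1 Alignments (definition of aligned pairs, projections, cost)] -/
@[simp] theorem alignmentCost_nil (C : EditCosts α) : alignmentCost C [] = 0 := rfl
/-- Computation rule (`alignmentCost_cons`): the definition, unfolded. [cite: CrochemoreHancartLecroq2007, §7.1 Alignments (definition of aligned pairs, projections, cost)] -/
@[simp] theorem alignmentCost_cons (C : EditCosts α) (p : AlignedPair α) (z : List (AlignedPair α)) :
    alignmentCost C (p :: z) = p.cost C + alignmentCost C z := by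
  simp [alignmentCost]

/-- The alignment made of insertions only (left projection). [cite: WagnerFischer1974, Theorem 3 (the only trace from or to the null string is the empty one: D(i, 0) = Σ γ(A(r) → Λ), D(0, j) = Σ γ(Λ → B(r)))] -/
@[simp] theorem projLeft_map_insert (ys : List α) : projLeft (ys.map .insert) = [] := by
  induction ys with
  | nil => rfl
  | cons b ys ih => simpa using ih

/-- The alignment made of insertions only (right projection). [cite: WagnerFischer1974, Theorem 3 (the only trace from or to the null string is the empty one: D(i, 0) = Σ γ(A(r) → Λ), D(0, j) = Σ γ(Λ → B(r)))] -/
@[simp] theorem projRight_map_insert (ys : List α) : projRight (ys.map .insert) = ys := by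
  induction ys with
  | nil => rfl
  | cons b ys ih => simpa using ih

/-- The alignment made of deletions only (left projection). [cite: WagnerFischer1974, Theorem 3 (the only trace from or to the null string is the empty one: D(i, 0) = Σ γ(A(r) → Λ), D(0, j) = Σ γ(Λ → B(r)))] -/
@[simp] theorem projLeft_map_delete (xs : List α) : projLeft (xs.map .delete) = xs := by
  induction xs with
  | nil => rfl
  | cons a xs ih => simpa using ih

/-- The alignment made of deletions only (right projection). [cite: WagnerFischer1974, Theorem 3 (the only trace from or to the null string is the empty one: D(i, 0) = Σ γ(A(r) → Λ), D(0, j) = Σ γ(Λ → B(r)))] -/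
@[simp] theorem projRight_map_delete (xs : List α) : projRight (xs.map .delete) = [] := by
  induction xs with
  | nil => rfl
  | cons a xs ih => simpa using ih

/-- Cost of the insertions-only alignment: `Σ Ins(y[j])`. [cite: WagnerFischer1974, Theorem 3 (the only trace from or to the null string is the empty one: D(i, 0) = Σ γ(A(r) → Λ), D(0, j) = Σ γ(Λ → B(r)))] -/
@[simp] theorem alignmentCost_map_insert (C : EditCosts α) (ys : List α) :
    alignmentCost C (ys.map .insert) = (ys.map C.ins).sum := by
  induction ys with
  | nil => rfl
  | cons b ys ih => simp [ih]

/-- Cost of the deletions-only alignment: `Σ Del(x[i])`. [cite: WagnerFischer1974, Theorem 3 (the only trace from or to the null string is the empty one: D(i, 0) = Σ γ(A(r) → Λ), D(0, j) = Σ γ(Λ → B(r)))] -/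
@[simp] theorem alignmentCost_map_delete (C : EditCosts α) (xs : List α) :
    alignmentCost C (xs.map .delete) = (xs.map C.del).sum := by
  induction xs with
  | nil => rfl
  | cons a xs ih => simp [ih]

/-- The empty string of pairs is an alignment between `x` and `y` iff both are empty. [cite: CrochemoreHancartLecroq2007, §7.1 Alignments (definition; the empty alignment)] -/
theorem IsAlignmentOf.nil_iff {x y : List α} : IsAlignmentOf [] x y ↔ x = [] ∧ y = [] := by
  simp [IsAlignmentOf, eq_comm]

/-! ### The edit distance `Lev` by the recurrence of Proposition 7.3 / Lemma 7.4 (§7.2) -/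

/-- One line of the dynamic-programming table: given the line `r = Lev(xs, ·)`, the line
`Lev(a·xs, ·)` (inner recursion on the second string; this nesting makes `lev` structurally
recursive, hence evaluable by `decide`). [cite: CrochemoreHancartLecroq2007, §7.2 Proposition 7.3 (one line of table T)] -/
def levRow (C : EditCosts α) (a : α) (r : List α → ℕ) : List α → ℕ
  | [] => r [] + C.del a
  | b :: ys => min (r ys + C.sub a b) (min (r (b :: ys) + C.del a) (levRow C a r ys + C.ins b))

/-- **The edit (alignment) distance `Lev(x, y)`** for the elementary costs `C`, computed by the
recurrence of Proposition 7.3 / Lemma 7.4 (algorithm Generic-DP), written on first letters: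
`Lev(ε, y) = Σ Ins(y[j])`, `Lev(a·u, ε) = Lev(u, ε) + Del(a)`,
`Lev(a·u, b·v) = min {Lev(u, v) + Sub(a, b), Lev(u, b·v) + Del(a), Lev(a·u, v) + Ins(b)}`.
That this is the minimum cost of the alignments between `x` and `y` is `isLeast_lev`.
[cite: CrochemoreHancartLecroq2007, §7.1 definition of Lev; §7.2 Proposition 7.3, Lemma 7.4, Corollary 7.5; WagnerFischer1974, Theorems 2 and 3 (the recurrence for D(i, j) = δ(A(1:i), B(1:j)), Algorithm X)] -/
def lev (C : EditCosts α) : List α → List α → ℕ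
  | [] => fun ys => (ys.map C.ins).sum
  | a :: xs => levRow C a (lev C xs)

section Recurrence

variable (C : EditCosts α)

/-- `Lev(ε, y)` is the total insertion cost of `y`. [cite: CrochemoreHancartLecroq2007, §7.2 Proposition 7.3 (T[-1, j])] -/
@[simp] theorem lev_nil_left (ys : List α) : lev C [] ys = (ys.map C.ins).sum := rfl

/-- `Lev(a·u, ε) = Lev(u, ε) + Del(a)`. [cite: CrochemoreHancartLecroq2007, §7.2 Proposition 7.3 (T[i, -1])] -/
theorem lev_cons_nil (a : α) (xs : List α) : lev C (a :: xs) [] = lev C xs [] + C.del a := rfl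

/-- `Lev(x, ε)` is the total deletion cost of `x`. [cite: CrochemoreHancartLecroq2007, §7.2 Proposition 7.3 (T[i, -1])] -/
@[simp] theorem lev_nil_right (xs : List α) : lev C xs [] = (xs.map C.del).sum := by
  induction xs with
  | nil => rfl
  | cons a xs ih => rw [lev_cons_nil, ih]; simp [Nat.add_comm]

/-- `Lev(ε, ε) = 0`. [cite: CrochemoreHancartLecroq2007, §7.2 Proposition 7.3 (T[-1, -1] = 0)] -/
@[simp] theorem lev_nil_nil : lev C [] [] = 0 := rfl

/-- **The recurrence** (Proposition 7.3 / Lemma 7.4, first-letter form):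
`Lev(a·u, b·v) = min {Lev(u, v) + Sub(a, b), Lev(u, b·v) + Del(a), Lev(a·u, v) + Ins(b)}`.
[cite: CrochemoreHancartLecroq2007, §7.2 Proposition 7.3, Lemma 7.4; WagnerFischer1974, Theorem 2] -/
theorem lev_cons_cons (a b : α) (xs ys : List α) :
    lev C (a :: xs) (b :: ys) =
      min (lev C xs ys + C.sub a b) (min (lev C xs (b :: ys) + C.del a) (lev C (a :: xs) ys + C.ins b)) :=
  rfl

/-- Deleting the first letter of `x` first: `Lev(a·u, y) ≤ Lev(u, y) + Del(a)` (one term of the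
recurrence). [cite: WagnerFischer1974, Theorem 2 (Case 2, m₂); CrochemoreHancartLecroq2007, §7.2 Proposition 7.3] -/
theorem lev_cons_left_le (a : α) (xs ys : List α) : lev C (a :: xs) ys ≤ lev C xs ys + C.del a := by
  cases ys with
  | nil => rw [lev_cons_nil]
  | cons b ys => rw [lev_cons_cons]; exact min_le_of_right_le (min_le_left _ _)

/-- Inserting the first letter of `y` first: `Lev(x, b·v) ≤ Lev(x, v) + Ins(b)` (one term of the
recurrence). [cite: WagnerFischer1974, Theorem 2 (Case 3, m₃); CrochemoreHancartLecroq2007, §7.2 Proposition 7.3] -/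
theorem lev_cons_right_le (b : α) (xs ys : List α) : lev C xs (b :: ys) ≤ lev C xs ys + C.ins b := by
  cases xs with
  | nil => simp [Nat.add_comm]
  | cons a xs => rw [lev_cons_cons]; exact min_le_of_right_le (min_le_right _ _)

/-- Substituting the first letters first: `Lev(a·u, b·v) ≤ Lev(u, v) + Sub(a, b)` (one term of the
recurrence). [cite: WagnerFischer1974, Theorem 2 (Case 1, m₁); CrochemoreHancartLecroq2007, §7.2 Proposition 7.3] -/
theorem lev_cons_cons_le (a b : α) (xs ys : List α) :
    lev C (a :: xs) (b :: ys) ≤ lev C xs ys + C.sub a b := by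
  rw [lev_cons_cons]; exact min_le_left _ _

/-- `Lev(a, ε) = Del(a)`. [cite: CrochemoreHancartLecroq2007, §7.1 Proposition 7.1 (proof, Del(a) = Lev(a, ε))] -/
@[simp] theorem lev_singleton_nil (a : α) : lev C [a] [] = C.del a := by simp

/-- `Lev(ε, b) = Ins(b)`. [cite: CrochemoreHancartLecroq2007, §7.1 Proposition 7.1 (proof, Lev(ε, a) = Ins(a))] -/
@[simp] theorem lev_nil_singleton (b : α) : lev C [] [b] = C.ins b := by simp

/-- On letters, `Lev(a, b) = min {Sub(a, b), Del(a) + Ins(b)}` (the book writes `Lev(a, b) = Sub(a, b)`,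
which is the case `Sub(a, b) ≤ Del(a) + Ins(b)`).
[cite: CrochemoreHancartLecroq2007, §7.1 Proposition 7.1 (proof, Lev(a, b) = Sub(a, b))] -/
theorem lev_singleton_singleton (a b : α) : lev C [a] [b] = min (C.sub a b) (C.del a + C.ins b) := by
  rw [lev_cons_cons, lev_nil_nil, lev_nil_singleton, lev_singleton_nil]; omega

end Recurrence

/-! ### `Lev` is the minimum cost of the alignments (§7.1 definition of `Lev`, §7.2 Prop. 7.3, 7.8) -/

section Optimal

variable (C : EditCosts α)

/-- **Lower bound**: every alignment between `x` and `y` costs at least `Lev(x, y)` (every path of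
the edit graph from `(-1, -1)` to `(m-1, n-1)` costs at least `T[m-1, n-1]`; Wagner–Fischer: `D(i, j)`
is the cost of the least cost trace, proof of Theorem 2).
[cite: CrochemoreHancartLecroq2007, §7.1 definition of Lev; §7.2 Proposition 7.3, Corollary 7.5; WagnerFischer1974, Theorems 1 and 2 (D(i, j) ≤ cost of every trace from A(1:i) to B(1:j))] -/
theorem lev_le_alignmentCost {z : List (AlignedPair α)} {x y : List α} (h : IsAlignmentOf z x y) :
    lev C x y ≤ alignmentCost C z := by
  induction z generalizing x y with
  | nil =>
    obtain ⟨rfl, rfl⟩ := IsAlignmentOf.nil_iff.1 h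
    simp
  | cons p z ih =>
    obtain ⟨hx, hy⟩ := h
    cases p with
    | subst a b =>
      simp only [projLeft_cons_subst, projRight_cons_subst] at hx hy
      subst hx hy
      rw [alignmentCost_cons, AlignedPair.cost_subst]
      have := ih (x := projLeft z) (y := projRight z) ⟨rfl, rfl⟩
      have := lev_cons_cons_le C a b (projLeft z) (projRight z)
      omega
    | delete a =>
      simp only [projLeft_cons_delete, projRight_cons_delete] at hx hy
      subst hx hy
      rw [alignmentCost_cons, AlignedPair.cost_delete]
      have := ih (x := projLeft z) (y := projRight z) ⟨rfl, rfl⟩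
      have := lev_cons_left_le C a (projLeft z) (projRight z)
      omega
    | insert b =>
      simp only [projLeft_cons_insert, projRight_cons_insert] at hx hy
      subst hx hy
      rw [alignmentCost_cons, AlignedPair.cost_insert]
      have := ih (x := projLeft z) (y := projRight z) ⟨rfl, rfl⟩
      have := lev_cons_right_le C b (projLeft z) (projRight z)
      omega

/-- **The traceback** (algorithm One-alignment, run on first letters): follow, at each step, one
of the three terms realising the minimum of the recurrence.
[cite: CrochemoreHancartLecroq2007, §7.2 algorithm One-alignment, Proposition 7.8; WagnerFischer1974, Algorithm Y (printing a least cost trace from the table D)] -/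
def oneAlignment : List α → List α → List (AlignedPair α)
  | [], ys => ys.map .insert
  | a :: xs, [] => (a :: xs).map .delete
  | a :: xs, b :: ys =>
      if lev C (a :: xs) (b :: ys) = lev C xs ys + C.sub a b then .subst a b :: oneAlignment xs ys
      else if lev C (a :: xs) (b :: ys) = lev C xs (b :: ys) + C.del a then
        .delete a :: oneAlignment xs (b :: ys)
      else .insert b :: oneAlignment (a :: xs) ys
termination_by x y => x.length + y.length

/-- The traceback is an alignment between `x` and `y`.
[cite: CrochemoreHancartLecroq2007, §7.2 Proposition 7.8; WagnerFischer1974, Theorem 4 (T(I, J) is a trace from A(1:I) to B(1:J))] -/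
theorem isAlignmentOf_oneAlignment : ∀ x y : List α, IsAlignmentOf (oneAlignment C x y) x y
  | [], ys => by simp [oneAlignment, IsAlignmentOf]
  | a :: xs, [] => by
      simp only [oneAlignment, IsAlignmentOf]
      exact ⟨projLeft_map_delete (a :: xs), projRight_map_delete (a :: xs)⟩
  | a :: xs, b :: ys => by
      have h1 := isAlignmentOf_oneAlignment xs ys
      have h2 := isAlignmentOf_oneAlignment xs (b :: ys)
      have h3 := isAlignmentOf_oneAlignment (a :: xs) ys
      unfold IsAlignmentOf at h1 h2 h3 ⊢
      simp only [oneAlignment]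
      split_ifs
      · simpa using h1
      · simpa using h2
      · simpa using h3
termination_by x y => x.length + y.length

/-- **The traceback is optimal**: its cost is `Lev(x, y)` ("One-alignment produces an optimal
alignment, that is to say an alignment of cost `Lev(x, y)`"; Wagner–Fischer: `cost(T(I, J)) = D(I, J)`).
[cite: CrochemoreHancartLecroq2007, §7.2 Proposition 7.8; WagnerFischer1974, Theorem 4 (cost (T(I, J)) = D(I, J))] -/
theorem alignmentCost_oneAlignment : ∀ x y : List α, alignmentCost C (oneAlignment C x y) = lev C x y
  | [], ys => by simp [oneAlignment]
  | a :: xs, [] => by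
      simp only [oneAlignment]
      rw [alignmentCost_map_delete, lev_nil_right]
  | a :: xs, b :: ys => by
      have h1 := alignmentCost_oneAlignment xs ys
      have h2 := alignmentCost_oneAlignment xs (b :: ys)
      have h3 := alignmentCost_oneAlignment (a :: xs) ys
      have hrec := lev_cons_cons C a b xs ys
      simp only [oneAlignment]
      split_ifs with e1 e2
      · rw [alignmentCost_cons, AlignedPair.cost_subst, h1]; omega
      · rw [alignmentCost_cons, AlignedPair.cost_delete, h2]; omega
      · rw [alignmentCost_cons, AlignedPair.cost_insert, h3]; omega
termination_by x y => x.length + y.length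

/-- Some alignment between `x` and `y` has cost exactly `Lev(x, y)`.
[cite: CrochemoreHancartLecroq2007, §7.2 Proposition 7.8; WagnerFischer1974, Theorem 4] -/
theorem exists_isAlignmentOf_alignmentCost_eq (x y : List α) :
    ∃ z, IsAlignmentOf z x y ∧ alignmentCost C z = lev C x y :=
  ⟨oneAlignment C x y, isAlignmentOf_oneAlignment C x y, alignmentCost_oneAlignment C x y⟩

/-- **`Lev(x, y) = min {cost of z : z an alignment between x and y}`** — the book's definition
of the edit distance (via sequences of edit operations represented as alignments) coincides with
the value of the recurrence / of the algorithm Generic-DP; in Wagner–Fischer's words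
`δ(A, B) = min {cost(T) | T is a trace from A to B}` together with Theorems 2–4.
[cite: WagnerFischer1974, Theorem 1 (with Theorems 2–4); CrochemoreHancartLecroq2007, §7.1 definition of Lev; §7.2 Proposition 7.3, Corollary 7.5, Proposition 7.8] -/
theorem isLeast_lev (x y : List α) :
    IsLeast {c | ∃ z, IsAlignmentOf z x y ∧ alignmentCost C z = c} (lev C x y) :=
  ⟨exists_isAlignmentOf_alignmentCost_eq C x y, fun _ ⟨_, hz, hc⟩ => hc ▸ lev_le_alignmentCost C hz⟩

/-- `Lev` is characterised by the two halves of `isLeast_lev` (`δ(A, B) = min {cost(T) | T a trace}`).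
[cite: WagnerFischer1974, Theorem 1; CrochemoreHancartLecroq2007, §7.1 (Lev as the minimum alignment cost), §7.2 Proposition 7.8] -/
theorem lev_eq_iff (x y : List α) (d : ℕ) :
    lev C x y = d ↔ (∃ z, IsAlignmentOf z x y ∧ alignmentCost C z = d) ∧
      ∀ z, IsAlignmentOf z x y → d ≤ alignmentCost C z := by
  constructor
  · rintro rfl
    exact ⟨exists_isAlignmentOf_alignmentCost_eq C x y, fun z hz => lev_le_alignmentCost C hz⟩
  · rintro ⟨⟨z, hz, hzc⟩, hmin⟩
    apply le_antisymm
    · exact hzc ▸ lev_le_alignmentCost C hz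
    · obtain ⟨z', hz', hc'⟩ := exists_isAlignmentOf_alignmentCost_eq C x y
      exact hc' ▸ hmin z' hz'

/-- The cost of an alignment is monotone in the elementary costs. [folklore] -/
private theorem alignmentCost_mono {C C' : EditCosts α} (h : ∀ p : AlignedPair α, p.cost C ≤ p.cost C')
    (z : List (AlignedPair α)) : alignmentCost C z ≤ alignmentCost C' z := by
  unfold alignmentCost
  exact List.sum_le_sum (fun p _ => h p)

/-- The cost of an alignment against a multiple of other elementary costs. [folklore] -/
private theorem alignmentCost_le_mul {C C' : EditCosts α} {k : ℕ} (h : ∀ p : AlignedPair α, p.cost C ≤ k * p.cost C')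
    (z : List (AlignedPair α)) : alignmentCost C z ≤ k * alignmentCost C' z := by
  induction z with
  | nil => simp
  | cons p z ih =>
    rw [alignmentCost_cons, alignmentCost_cons, Nat.mul_add]
    exact Nat.add_le_add (h p) ih

/-- **Monotonicity in the costs**: if every aligned pair is cheaper for `C` than for `C'`, then
`Lev_C ≤ Lev_{C'}` (immediate from `δ = min cost of a trace`: compare an optimal trace for `C'`
termwise). [cite: WagnerFischer1974, Theorem 1 (immediate consequence: δ_γ is monotone in the cost function γ)] -/
theorem lev_mono {C C' : EditCosts α} (h : ∀ p : AlignedPair α, p.cost C ≤ p.cost C') (x y : List α) :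
    lev C x y ≤ lev C' x y := by
  obtain ⟨z, hz, hc⟩ := exists_isAlignmentOf_alignmentCost_eq C' x y
  rw [← hc]
  exact (lev_le_alignmentCost C hz).trans (alignmentCost_mono h z)

/-- Comparison with a multiple: if every aligned pair costs for `C` at most `k` times its cost
for `C'`, then `Lev_C ≤ k · Lev_{C'}` (same argument). [cite: WagnerFischer1974, Theorem 1 (immediate consequence: termwise comparison of an optimal trace)] -/
theorem lev_le_mul_lev {C C' : EditCosts α} {k : ℕ} (h : ∀ p : AlignedPair α, p.cost C ≤ k * p.cost C')
    (x y : List α) : lev C x y ≤ k * lev C' x y := by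
  obtain ⟨z, hz, hc⟩ := exists_isAlignmentOf_alignmentCost_eq C' x y
  rw [← hc]
  exact (lev_le_alignmentCost C hz).trans (alignmentCost_le_mul h z)

end Optimal

/-! ### Reversal and Lemma 7.4 in the book's last-letter form -/

section Reverse

variable (C : EditCosts α)

/-- Projections commute with reversal. [folklore] -/
private theorem projLeft_reverse (z : List (AlignedPair α)) : projLeft z.reverse = (projLeft z).reverse := by
  simp [projLeft, List.filterMap_reverse]

/-- Projections commute with reversal. [folklore] -/
private theorem projRight_reverse (z : List (AlignedPair α)) : projRight z.reverse = (projRight z).reverse := by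
  simp [projRight, List.filterMap_reverse]

/-- The cost of an alignment does not depend on the order of its pairs under reversal. [folklore] -/
private theorem alignmentCost_reverse (z : List (AlignedPair α)) : alignmentCost C z.reverse = alignmentCost C z := by
  simp [alignmentCost, List.map_reverse, List.sum_reverse]

/-- The reverse of an alignment between `x` and `y` is an alignment between the reversed strings
("we obtain symmetric statements by reversing all involved strings").
[cite: BringmannKunnemannFOCS2015, §5.2 (reversal symmetry); CrochemoreHancartLecroq2007, §7.1 Alignments (definition)] -/
theorem IsAlignmentOf.reverse {z : List (AlignedPair α)} {x y : List α} (h : IsAlignmentOf z x y) :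
    IsAlignmentOf z.reverse x.reverse y.reverse := by
  obtain ⟨hx, hy⟩ := h
  exact ⟨by rw [projLeft_reverse, hx], by rw [projRight_reverse, hy]⟩

/-- **`Lev` is invariant under reversing both strings** (an alignment read backwards is an
alignment of the reversed strings with the same cost; with `δ = min cost of a trace` this is the
reversal symmetry "we obtain symmetric statements by reversing all involved strings").
[cite: WagnerFischer1974, Theorem 1 (with §3: a trace read backwards is a trace of the reversed strings); BringmannKunnemannFOCS2015, §5.2 (reversal symmetry)] -/
theorem lev_reverse (x y : List α) : lev C x.reverse y.reverse = lev C x y := by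
  apply le_antisymm
  · obtain ⟨z, hz, hc⟩ := exists_isAlignmentOf_alignmentCost_eq C x y
    rw [← hc, ← alignmentCost_reverse C z]
    exact lev_le_alignmentCost C hz.reverse
  · obtain ⟨z, hz, hc⟩ := exists_isAlignmentOf_alignmentCost_eq C x.reverse y.reverse
    rw [← hc, ← alignmentCost_reverse C z]
    have h' := hz.reverse
    rw [List.reverse_reverse, List.reverse_reverse] at h'
    exact lev_le_alignmentCost C h'

/-- **Lemma 7.4 (1)**: `Lev(ua, ε) = Lev(u, ε) + Del(a)`. [cite: CrochemoreHancartLecroq2007, §7.2 Lemma 7.4] -/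
theorem lev_concat_nil (u : List α) (a : α) : lev C (u ++ [a]) [] = lev C u [] + C.del a := by
  simp

/-- **Lemma 7.4 (2)**: `Lev(ε, vb) = Lev(ε, v) + Ins(b)`. [cite: CrochemoreHancartLecroq2007, §7.2 Lemma 7.4] -/
theorem lev_nil_concat (v : List α) (b : α) : lev C [] (v ++ [b]) = lev C [] v + C.ins b := by
  simp

/-- **Lemma 7.4 (3)** / Proposition 7.3 in the book's form, on last letters:
`Lev(ua, vb) = min {Lev(u, v) + Sub(a, b), Lev(u, vb) + Del(a), Lev(ua, v) + Ins(b)}`.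
[cite: CrochemoreHancartLecroq2007, §7.2 Lemma 7.4, Proposition 7.3] -/
theorem lev_concat_concat (u v : List α) (a b : α) :
    lev C (u ++ [a]) (v ++ [b]) =
      min (lev C u v + C.sub a b) (min (lev C u (v ++ [b]) + C.del a) (lev C (u ++ [a]) v + C.ins b)) := by
  have h0 : lev C (u ++ [a]) (v ++ [b]) = lev C (a :: u.reverse) (b :: v.reverse) := by
    rw [← lev_reverse C (u ++ [a]) (v ++ [b])]; simp
  have h1 : lev C u.reverse (b :: v.reverse) = lev C u (v ++ [b]) := by
    rw [← lev_reverse C u (v ++ [b])]; simp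
  have h2 : lev C (a :: u.reverse) v.reverse = lev C (u ++ [a]) v := by
    rw [← lev_reverse C (u ++ [a]) v]; simp
  rw [h0, lev_cons_cons, lev_reverse, h1, h2]

end Reverse

/-! ### Proposition 7.1: when is `Lev` a distance -/

section Metric

variable (C : EditCosts α)

/-- `Lev(x, x) = 0` as soon as `Sub(a, a) = 0` (align letter by letter).
[cite: CrochemoreHancartLecroq2007, §7.1 Proposition 7.1 (⇐, separation: "if u = v then Lev(u, v) = 0")] -/
theorem lev_self (hsub : ∀ a, C.sub a a = 0) (x : List α) : lev C x x = 0 := by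
  induction x with
  | nil => rfl
  | cons a xs ih =>
    apply Nat.eq_zero_of_le_zero
    have := lev_cons_cons_le C a a xs xs
    rw [ih, hsub] at this
    exact this

/-- **Separation**: if the only aligned pairs of null cost are the pairs `(a, a)`, then
`Lev(x, y) = 0` forces `x = y`.
[cite: CrochemoreHancartLecroq2007, §7.1 Proposition 7.1 (⇐, separation)] -/
theorem eq_of_lev_eq_zero (hsub : ∀ a b, C.sub a b = 0 → a = b) (hdel : ∀ a, 0 < C.del a)
    (hins : ∀ b, 0 < C.ins b) : ∀ x y : List α, lev C x y = 0 → x = y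
  | [], [], _ => rfl
  | [], b :: ys, h => by
      have := hins b
      simp at h
      omega
  | a :: xs, [], h => by
      have := hdel a
      rw [lev_cons_nil] at h
      omega
  | a :: xs, b :: ys, h => by
      have h1 := eq_of_lev_eq_zero hsub hdel hins xs ys
      have hrec := lev_cons_cons C a b xs ys
      have hda := hdel a
      have hib := hins b
      have hs : lev C xs ys = 0 ∧ C.sub a b = 0 := by omega
      rw [hsub a b hs.2, h1 hs.1]

/-- **Separation** as an equivalence: `Lev(x, y) = 0 ↔ x = y` when `Sub(a, b) = 0 ↔ a = b` and
`Del, Ins > 0`. [cite: CrochemoreHancartLecroq2007, §7.1 Proposition 7.1 (⇐, separation)] -/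
theorem lev_eq_zero_iff (hsub : ∀ a b, C.sub a b = 0 ↔ a = b) (hdel : ∀ a, 0 < C.del a)
    (hins : ∀ b, 0 < C.ins b) (x y : List α) : lev C x y = 0 ↔ x = y :=
  ⟨eq_of_lev_eq_zero C (fun a b => (hsub a b).1) hdel hins x y,
    fun h => h ▸ lev_self C (fun a => (hsub a a).2 rfl) x⟩

/-- **Symmetry**: if `Sub` is symmetric and `Del = Ins`, then `Lev(x, y) = Lev(y, x)` (reverse the
roles of deletions and insertions).
[cite: CrochemoreHancartLecroq2007, §7.1 Proposition 7.1 (⇐, symmetry)] -/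
theorem lev_comm (hsub : ∀ a b, C.sub a b = C.sub b a) (hdi : ∀ a, C.del a = C.ins a) :
    ∀ x y : List α, lev C x y = lev C y x
  | [], ys => by
      rw [lev_nil_left, lev_nil_right]
      exact congrArg List.sum (List.map_congr_left fun a _ => (hdi a).symm)
  | a :: xs, [] => by
      rw [lev_nil_left, lev_nil_right]
      exact congrArg List.sum (List.map_congr_left fun a _ => hdi a)
  | a :: xs, b :: ys => by
      have h1 := lev_comm hsub hdi xs ys
      have h2 := lev_comm hsub hdi xs (b :: ys)
      have h3 := lev_comm hsub hdi (a :: xs) ys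
      rw [lev_cons_cons, lev_cons_cons, h1, h2, h3, hsub a b, hdi a, ← hdi b, min_comm (lev C ys (a :: xs) + _)]

/-- Undoing an insertion: `Lev(u, y) ≤ Lev(a·u, y) + Ins(a)`, provided `Ins(c) ≤ Sub(a, c) + Ins(a)`
(an insertion of `c` is never dearer than inserting `a` and substituting). [folklore] -/
private theorem lev_le_lev_cons_left (hins : ∀ a c, C.ins c ≤ C.sub a c + C.ins a) (a : α) (xs : List α) :
    ∀ ys : List α, lev C xs ys ≤ lev C (a :: xs) ys + C.ins a
  | [] => by rw [lev_cons_nil]; omega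
  | c :: ys => by
      have ih := lev_le_lev_cons_left hins a xs ys
      have h1 := lev_cons_right_le C c xs ys
      have h2 := hins a c
      rw [lev_cons_cons]
      omega

/-- Undoing a deletion: `Lev(x, v) ≤ Lev(x, b·v) + Del(b)`, provided `Del(a) ≤ Sub(a, b) + Del(b)`.
[folklore] -/
private theorem lev_le_lev_cons_right (hdel : ∀ a b, C.del a ≤ C.sub a b + C.del b) (b : α) (ys : List α) :
    ∀ xs : List α, lev C xs ys ≤ lev C xs (b :: ys) + C.del b
  | [] => by simp only [lev_nil_left, List.map_cons, List.sum_cons]; omega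
  | a :: xs => by
      have ih := lev_le_lev_cons_right hdel b ys xs
      have h1 := lev_cons_left_le C a xs ys
      have h2 := hdel a b
      rw [lev_cons_cons]
      omega

/-- Triangle inequality through the empty string: `Lev(x, z) ≤ Lev(x, ε) + Lev(ε, z)` (delete
everything, then insert everything). [folklore] -/
private theorem lev_le_lev_nil_add_lev_nil : ∀ x z : List α, lev C x z ≤ lev C x [] + lev C [] z
  | [], z => by simp
  | a :: xs, z => by
      have ih := lev_le_lev_nil_add_lev_nil xs z
      have h1 := lev_cons_left_le C a xs z
      rw [lev_cons_nil]
      omega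

/-- Triangle inequality with the empty string on the left. [folklore] -/
private theorem lev_nil_le_add (hins : ∀ a c, C.ins c ≤ C.sub a c + C.ins a) :
    ∀ y z : List α, lev C [] z ≤ lev C [] y + lev C y z
  | [], z => by simp
  | b :: ys, z => by
      have ih := lev_nil_le_add hins ys z
      have h1 := lev_le_lev_cons_left C hins b ys z
      have e : lev C [] (b :: ys) = C.ins b + lev C [] ys := by simp
      omega

/-- The substitution branch of the triangle inequality, by induction on the third string. [folklore] -/
private theorem lev_cons_le_of_forall (hsub : ∀ a b c, C.sub a c ≤ C.sub a b + C.sub b c)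
    (hdel : ∀ a b, C.del a ≤ C.sub a b + C.del b) (a b : α) (xs ys : List α)
    (IH : ∀ z, lev C xs z ≤ lev C xs ys + lev C ys z) :
    ∀ z : List α, lev C (a :: xs) z ≤ lev C xs ys + C.sub a b + lev C (b :: ys) z
  | [] => by
      have h0 := IH []
      have h1 := hdel a b
      rw [lev_cons_nil, lev_cons_nil]
      omega
  | c :: zs => by
      have ihz := lev_cons_le_of_forall hsub hdel a b xs ys IH zs
      have hS := lev_cons_cons_le C a c xs zs
      have hD := lev_cons_left_le C a xs (c :: zs)
      have hI := lev_cons_right_le C c (a :: xs) zs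
      have i1 := IH zs
      have i2 := IH (c :: zs)
      have t1 := hsub a b c
      have t2 := hdel a b
      rw [lev_cons_cons C b c ys zs]
      omega

/-- **Triangle inequality** `Lev(x, z) ≤ Lev(x, y) + Lev(y, z)`, under the triangle inequality
for `Sub` and the gap/substitution compatibilities `Del(a) ≤ Sub(a, b) + Del(b)`,
`Ins(c) ≤ Sub(a, c) + Ins(a)` — i.e. under Wagner–Fischer's standing assumption "`γ(a → b) +
γ(b → c) ≥ γ(a → c)`" read over `A ∪ {Λ}` (the instances with `c = Λ`, resp. `a = Λ`; both automatic
for a constant gap cost; see the module docstring for why they cannot be dropped, which the book's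
statement does).  Proof along the recursion (Wagner–Fischer prove it by composing traces, Lemma 1).
[cite: CrochemoreHancartLecroq2007, §7.1 Proposition 7.1 (⇐, triangle inequality); WagnerFischer1974, §2 (standing assumption γ(a → b) + γ(b → c) ≥ γ(a → c)) and §3 Lemma 1 (cost (T₁ ∘ T₂) ≤ cost T₁ + cost T₂)] -/
theorem lev_triangle (hsub : ∀ a b c, C.sub a c ≤ C.sub a b + C.sub b c)
    (hdel : ∀ a b, C.del a ≤ C.sub a b + C.del b) (hins : ∀ a c, C.ins c ≤ C.sub a c + C.ins a) :
    ∀ x y z : List α, lev C x z ≤ lev C x y + lev C y z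
  | [], y, z => lev_nil_le_add C hins y z
  | a :: xs, [], z => by
      have h := lev_le_lev_nil_add_lev_nil C (a :: xs) z
      simpa using h
  | a :: xs, b :: ys, z => by
      have IH1 : ∀ w, lev C xs w ≤ lev C xs ys + lev C ys w := fun w => lev_triangle hsub hdel hins xs ys w
      have IH2 := lev_triangle hsub hdel hins xs (b :: ys) z
      have IH3 := lev_triangle hsub hdel hins (a :: xs) ys z
      have hS := lev_cons_le_of_forall C hsub hdel a b xs ys IH1 z
      have hD := lev_cons_left_le C a xs z
      have hI := lev_le_lev_cons_left C hins b ys z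
      rw [lev_cons_cons]
      omega

/-- The hypotheses of Proposition 7.1 (⇐) under which `Lev` is a distance on `A*`: `Sub` is a
distance on `A` (`sub_self`, `eq_of_sub_eq_zero`, `sub_comm`, `sub_triangle`), `Del(a) = Ins(a) > 0`
(`del_eq_ins`, `del_pos`), together with the gap/substitution compatibility `del_le`
(`Del(a) ≤ Sub(a, b) + Del(b)`) that the triangle inequality of the ALIGNMENT distance needs and
that holds for every constant gap cost (`EditCosts.IsMetric.ofGap`) — Wagner–Fischer's standing
assumption (the triangle inequality for `γ` over `A ∪ {Λ}`) restricted to what is used; "if `γ` were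
symmetric and strictly positive on each edit operation `a → b` for which `a ≠ b`, then `δ` would be a
metric on the space of all strings".
[cite: CrochemoreHancartLecroq2007, §7.1 Proposition 7.1 (hypotheses); WagnerFischer1974, §2 (standing assumption; remark that δ is then a metric)] -/
structure EditCosts.IsMetric (C : EditCosts α) : Prop where
  /-- `Sub(a, a) = 0`. -/
  sub_self : ∀ a, C.sub a a = 0
  /-- `Sub(a, b) = 0` only if `a = b`. -/
  eq_of_sub_eq_zero : ∀ a b, C.sub a b = 0 → a = b
  /-- `Sub` is symmetric. -/
  sub_comm : ∀ a b, C.sub a b = C.sub b a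
  /-- `Sub` satisfies the triangle inequality. -/
  sub_triangle : ∀ a b c, C.sub a c ≤ C.sub a b + C.sub b c
  /-- `Del(a) = Ins(a)`. -/
  del_eq_ins : ∀ a, C.del a = C.ins a
  /-- `Del(a) > 0`. -/
  del_pos : ∀ a, 0 < C.del a
  /-- Gap/substitution compatibility `Del(a) ≤ Sub(a, b) + Del(b)` (Wagner–Fischer's triangle
  inequality `γ(a → Λ) ≤ γ(a → b) + γ(b → Λ)`; absent from the book's statement, see above). -/
  del_le : ∀ a b, C.del a ≤ C.sub a b + C.del b

namespace EditCosts.IsMetric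

variable {C}

/-- A distance `d` on the letters and a constant positive gap cost `g` satisfy the hypotheses
(the compatibility `g ≤ d(a, b) + g` being trivial). [cite: CrochemoreHancartLecroq2007, §7.1 Proposition 7.1 (hypotheses)] -/
theorem ofGap {d : α → α → ℕ} (h0 : ∀ a, d a a = 0) (h1 : ∀ a b, d a b = 0 → a = b)
    (h2 : ∀ a b, d a b = d b a) (h3 : ∀ a b c, d a c ≤ d a b + d b c) {g : ℕ} (hg : 0 < g) :
    (⟨d, fun _ => g, fun _ => g⟩ : EditCosts α).IsMetric where
  sub_self := h0
  eq_of_sub_eq_zero := h1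
  sub_comm := h2
  sub_triangle := h3
  del_eq_ins _ := rfl
  del_pos _ := hg
  del_le _ _ := Nat.le_add_left g _

/-- Under the hypotheses, `Ins(c) ≤ Sub(a, c) + Ins(a)` as well. [folklore] -/
private theorem ins_le (h : C.IsMetric) (a c : α) : C.ins c ≤ C.sub a c + C.ins a := by
  rw [← h.del_eq_ins, ← h.del_eq_ins, h.sub_comm]; exact h.del_le c a

/-- **Proposition 7.1 (⇐), positivity/separation**: `Lev(x, y) = 0 ↔ x = y`.
[cite: CrochemoreHancartLecroq2007, §7.1 Proposition 7.1 (⇐, separation)] -/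
theorem lev_eq_zero_iff (h : C.IsMetric) (x y : List α) : lev C x y = 0 ↔ x = y :=
  StringMatching.lev_eq_zero_iff C (fun a b => ⟨h.eq_of_sub_eq_zero a b, fun e => e ▸ h.sub_self a⟩)
    h.del_pos (fun b => (h.del_eq_ins b) ▸ h.del_pos b) x y

/-- **Proposition 7.1 (⇐), reflexivity**: `Lev(x, x) = 0`.
[cite: CrochemoreHancartLecroq2007, §7.1 Proposition 7.1 (⇐, separation)] -/
theorem lev_self (h : C.IsMetric) (x : List α) : lev C x x = 0 := StringMatching.lev_self C h.sub_self x

/-- **Proposition 7.1 (⇐), symmetry**: `Lev(x, y) = Lev(y, x)`.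
[cite: CrochemoreHancartLecroq2007, §7.1 Proposition 7.1 (⇐, symmetry)] -/
theorem lev_comm (h : C.IsMetric) (x y : List α) : lev C x y = lev C y x :=
  StringMatching.lev_comm C h.sub_comm h.del_eq_ins x y

/-- **Proposition 7.1 (⇐), triangle inequality**: `Lev(x, z) ≤ Lev(x, y) + Lev(y, z)`.
[cite: CrochemoreHancartLecroq2007, §7.1 Proposition 7.1 (⇐, triangle inequality)] -/
theorem lev_triangle (h : C.IsMetric) (x y z : List α) : lev C x z ≤ lev C x y + lev C y z :=
  StringMatching.lev_triangle C h.sub_triangle h.del_le h.ins_le x y z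

end EditCosts.IsMetric

/-- The compatibility hypothesis cannot be dropped from Proposition 7.1 (⇐) for the alignment
distance: on `A = Bool` take `Sub(a, b) = [a ≠ b]` (a distance on `A`) and `Del = Ins`, equal to
`1` on `false` and to `3` on `true`; then `Lev(ε, true) = 3` while
`Lev(ε, false) + Lev(false, true) = 1 + 1 = 2`, so the triangle inequality fails.
[cite: CrochemoreHancartLecroq2007, §7.1 Proposition 7.1 (a counter-example to the literal reading)] -/
example :
    let C : EditCosts Bool :=
      ⟨fun a b => if a = b then 0 else 1, fun a => if a then 3 else 1, fun a => if a then 3 else 1⟩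
    lev C [] [true] = 3 ∧ lev C [] [false] = 1 ∧ lev C [false] [true] = 1 ∧
      ¬ lev C [] [true] ≤ lev C [] [false] + lev C [false] [true] := by
  decide

end Metric

/-- A list of ones sums to the length. [folklore] -/
private theorem sum_map_eq_length {f : α → ℕ} (hf : ∀ a, f a = 1) (l : List α) :
    (l.map f).sum = l.length := by
  induction l with
  | nil => rfl
  | cons a l ih => simp only [List.map_cons, List.sum_cons, List.length_cons, ih, hf]; omega

/-! ### Unit costs: the tree's `editDist` (Figures 7.1, 7.2, 7.8) -/

section Unit

variable [DecidableEq α]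

/-- **Unit costs**: `Sub(a, a) = 0`, `Sub(a, b) = 1` for `a ≠ b`, `Del(a) = Ins(a) = 1`
(the costs of Figures 7.1, 7.2 and 7.8). [cite: CrochemoreHancartLecroq2007, §7.1 Figure 7.1 (unit costs)] -/
def unitCosts : EditCosts α := ⟨fun a b => if a = b then 0 else 1, fun _ => 1, fun _ => 1⟩

/-- Computation rule (`unitCosts_sub`): the definition, unfolded. [cite: CrochemoreHancartLecroq2007, §7.1 Figure 7.1 (unit costs)] -/
@[simp] theorem unitCosts_sub (a b : α) : (unitCosts : EditCosts α).sub a b = if a = b then 0 else 1 := rfl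
/-- Computation rule (`unitCosts_del`): the definition, unfolded. [cite: CrochemoreHancartLecroq2007, §7.1 Figure 7.1 (unit costs)] -/
@[simp] theorem unitCosts_del (a : α) : (unitCosts : EditCosts α).del a = 1 := rfl
/-- Computation rule (`unitCosts_ins`): the definition, unfolded. [cite: CrochemoreHancartLecroq2007, §7.1 Figure 7.1 (unit costs)] -/
@[simp] theorem unitCosts_ins (b : α) : (unitCosts : EditCosts α).ins b = 1 := rfl

/-- Unit costs satisfy the hypotheses of Proposition 7.1 (⇐) (constant gap cost `1`).
[cite: CrochemoreHancartLecroq2007, §7.1 Proposition 7.1, Figure 7.1] -/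
theorem unitCosts_isMetric : (unitCosts : EditCosts α).IsMetric :=
  EditCosts.IsMetric.ofGap (d := fun a b : α => if a = b then 0 else 1) (by simp)
    (by intro a b h; by_contra hne; simp [hne] at h) (by intro a b; by_cases h : a = b <;> simp [h, eq_comm])
    (by intro a b c; by_cases hab : a = b <;> by_cases hbc : b = c <;> by_cases hac : a = c <;> simp_all)
    Nat.one_pos

/-- **With unit costs `Lev` is the tree's `editDist`** (Wagner–Fischer / Levenshtein distance of
`Literature.Computability.Cryptography.SequenceProblems`): both satisfy the same recurrence.
[cite: CrochemoreHancartLecroq2007, §7.1 Figure 7.1; §7.2 Proposition 7.3] -/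
theorem lev_unitCosts : ∀ x y : List α, lev unitCosts x y = editDist x y
  | [], ys => by rw [lev_nil_left, editDist_nil_left]; exact sum_map_eq_length (fun _ => rfl) ys
  | a :: xs, [] => by rw [lev_nil_right, editDist_nil_right]; exact sum_map_eq_length (fun _ => rfl) (a :: xs)
  | a :: xs, b :: ys => by
      have h1 := lev_unitCosts xs ys
      have h2 := lev_unitCosts xs (b :: ys)
      have h3 := lev_unitCosts (a :: xs) ys
      rw [lev_cons_cons, editDist_cons_cons, h1, h2, h3, unitCosts_sub, unitCosts_del, unitCosts_ins]
      split_ifs <;> omega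

/-- Hence **`editDist x y` is the minimum, over the alignments between `x` and `y`, of the number of
non-matching aligned pairs** (substitutions of distinct letters, deletions, insertions).
[cite: CrochemoreHancartLecroq2007, §7.1 definition of Lev, Figure 7.2; §7.2 Proposition 7.8] -/
theorem isLeast_editDist (x y : List α) :
    IsLeast {c | ∃ z, IsAlignmentOf z x y ∧ alignmentCost unitCosts z = c} (editDist x y) := by
  rw [← lev_unitCosts]; exact isLeast_lev unitCosts x y

/-- Every alignment has at least `editDist x y` non-matching pairs. [cite: CrochemoreHancartLecroq2007, §7.2 Corollary 7.5 (unit costs)] -/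
theorem editDist_le_alignmentCost {z : List (AlignedPair α)} {x y : List α} (h : IsAlignmentOf z x y) :
    editDist x y ≤ alignmentCost unitCosts z := by
  rw [← lev_unitCosts]; exact lev_le_alignmentCost unitCosts h

end Unit

section Example

/-- The four-letter alphabet of the book's running example. [cite: CrochemoreHancartLecroq2007, §7.1 Figure 7.1 (alphabet A, C, G, T)] -/
private inductive Nuc | A | C | G | T
  deriving DecidableEq

open Nuc in
/-- The book's running example (Figures 7.1, 7.2, 7.8): with unit costs `Lev(ACGA, ATGCTA) = 3`,
and the alignment `(A,A)(C,T)(G,G)(-,C)(-,T)(A,A)` of Figure 7.2 is an alignment between the two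
strings of cost `0 + 1 + 0 + 1 + 1 + 0 = 3`, hence optimal.
[cite: CrochemoreHancartLecroq2007, §7.1 Figures 7.1–7.2; §7.2 Figure 7.8] -/
example :
    lev unitCosts [A, C, G, A] [A, T, G, C, T, A] = 3 ∧
      IsAlignmentOf [.subst A A, .subst C T, .subst G G, .insert C, .insert T, .subst A A]
        [A, C, G, A] [A, T, G, C, T, A] ∧
      alignmentCost unitCosts
        [.subst A A, .subst C T, .subst G G, .insert C, .insert T, .subst A A] = 3 := by
  decide

end Example

/-! ### §7.3: the subsequence distance (Proposition 7.11) -/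

section Subsequence

variable [DecidableEq α] (C : EditCosts α)

/-- One more letter on one side changes `lcs` by at most one. [folklore] -/
private theorem lcsLength_cons_right_le (xs : List α) (b : α) (ys : List α) :
    lcsLength xs (b :: ys) ≤ lcsLength xs ys + 1 := by
  obtain ⟨s, hx, hy, hs⟩ := exists_common_sublist xs (b :: ys)
  rw [← hs]
  rcases List.sublist_cons_iff.1 hy with h | ⟨r, rfl, hr⟩
  · exact (hx.length_le_lcsLength h).trans (Nat.le_succ _)
  · have hr' : r.Sublist xs := (List.sublist_cons_self b r).trans hx
    simpa using hr'.length_le_lcsLength hr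

/-- One more letter on one side changes `lcs` by at most one. [folklore] -/
private theorem lcsLength_cons_left_le (a : α) (xs ys : List α) :
    lcsLength (a :: xs) ys ≤ lcsLength xs ys + 1 := by
  rw [lcsLength_comm, lcsLength_comm xs]; exact lcsLength_cons_right_le ys a xs

/-- **Proposition 7.11** (`d_subs(x, y) = |x| + |y| - 2·lcs(x, y)`), additive form: for costs with
`Sub(a, a) = 0`, `Del(a) = Ins(a) = 1` and `Sub(a, b) ≥ 2` for `a ≠ b` (the book: `> 2`), the edit
distance satisfies `Lev(x, y) + 2·lcs(x, y) = |x| + |y|` (Wagner–Fischer, §5, for `Sub(a, b) = 2`: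
"`ρ(A, B) = (|A| + |B| - δ(A, B)) / 2`").
[cite: CrochemoreHancartLecroq2007, §7.3 Proposition 7.11, eq. (7.1); WagnerFischer1974, §5 (cost (T) = |A| + |B| - 2ρ(A, B) for the costs 1, 1, 0, 2)] -/
theorem lev_add_two_mul_lcsLength (hsub0 : ∀ a, C.sub a a = 0) (hsub2 : ∀ a b, a ≠ b → 2 ≤ C.sub a b)
    (hdel : ∀ a, C.del a = 1) (hins : ∀ b, C.ins b = 1) :
    ∀ x y : List α, lev C x y + 2 * lcsLength x y = x.length + y.length
  | [], ys => by rw [lev_nil_left, lcsLength_nil_left, sum_map_eq_length hins]; simp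
  | a :: xs, [] => by rw [lev_nil_right, lcsLength_nil_right, sum_map_eq_length hdel]; simp
  | a :: xs, b :: ys => by
      have h1 := lev_add_two_mul_lcsLength hsub0 hsub2 hdel hins xs ys
      have h2 := lev_add_two_mul_lcsLength hsub0 hsub2 hdel hins xs (b :: ys)
      have h3 := lev_add_two_mul_lcsLength hsub0 hsub2 hdel hins (a :: xs) ys
      have m2 := lcsLength_cons_right_le xs b ys
      have m2' := lcsLength_mono_right xs (List.sublist_cons_self b ys)
      have m3 := lcsLength_cons_left_le a xs ys
      have m3' := lcsLength_mono_left (List.sublist_cons_self a xs) ys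
      rw [lev_cons_cons, lcsLength_cons_cons, hdel, hins]
      simp only [List.length_cons] at h2 h3 ⊢
      by_cases hab : a = b
      · subst hab
        rw [if_pos rfl, hsub0]
        omega
      · rw [if_neg hab]
        have hs := hsub2 a b hab
        omega

/-- **Proposition 7.11**: under the same hypotheses `Lev(x, y)` is the subsequence distance
`d_subs(x, y) = |x| + |y| - 2·lcs(x, y)`, the tree's `dLCS` (Bringmann–Künnemann's `δ_LCS`,
"equivalent to EDIT(1,1,0,2)"). [cite: CrochemoreHancartLecroq2007, §7.3 Proposition 7.11, eq. (7.1); WagnerFischer1974, §5] -/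
theorem lev_eq_dLCS (hsub0 : ∀ a, C.sub a a = 0) (hsub2 : ∀ a b, a ≠ b → 2 ≤ C.sub a b)
    (hdel : ∀ a, C.del a = 1) (hins : ∀ b, C.ins b = 1) (x y : List α) : lev C x y = dLCS x y := by
  have h1 := lev_add_two_mul_lcsLength C hsub0 hsub2 hdel hins x y
  have h2 := dLCS_add x y
  omega

/-- The **indel costs** `Sub(a, a) = 0`, `Sub(a, b) = 2` (`a ≠ b`), `Del = Ins = 1`
(Bringmann–Künnemann's `EDIT(1,1,0,2)`; any value `≥ 2`, or forbidding substitutions, gives the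
same distance by `lev_eq_dLCS`). [cite: WagnerFischer1974, §5 ("the cost of an insert or a delete operation is 1, … a change operation a → b … 0 if a = b and 2 if a ≠ b"); CrochemoreHancartLecroq2007, §7.3 (costs defining d_subs)] -/
def indelCosts : EditCosts α := ⟨fun a b => if a = b then 0 else 2, fun _ => 1, fun _ => 1⟩

/-- `Lev` for the indel costs is `dLCS`. [cite: WagnerFischer1974, §5; CrochemoreHancartLecroq2007, §7.3 Proposition 7.11] -/
theorem lev_indelCosts (x y : List α) : lev indelCosts x y = dLCS x y :=
  lev_eq_dLCS indelCosts (by simp [indelCosts]) (by intro a b h; simp [indelCosts, h]) (fun _ => rfl)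
    (fun _ => rfl) x y

/-- Hence **`dLCS x y` is the minimum number of unaligned letters** (insertions plus deletions) over
the alignments between `x` and `y` that use no substitution of distinct letters — typed as:
the minimum of the indel cost over all alignments.
[cite: CrochemoreHancartLecroq2007, §7.3 Proposition 7.11 (proof)] -/
theorem isLeast_dLCS (x y : List α) :
    IsLeast {c | ∃ z, IsAlignmentOf z x y ∧ alignmentCost indelCosts z = c} (dLCS x y) := by
  rw [← lev_indelCosts]; exact isLeast_lev indelCosts x y

/-- `editDist ≤ dLCS`: the unit cost assignment is dominated termwise by the LCS cost assignment
(`1/1/0/1 ≤ 1/1/0/2`), so the minima over traces compare.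
[cite: WagnerFischer1974, §5 with Theorem 1 (immediate consequence: termwise comparison of the two cost assignments)] -/
theorem editDist_le_dLCS (x y : List α) : editDist x y ≤ dLCS x y := by
  rw [← lev_unitCosts, ← lev_indelCosts]
  refine lev_mono (fun p => ?_) x y
  cases p with
  | subst a b => by_cases h : a = b <;> simp [indelCosts, h]
  | delete a => simp [indelCosts]
  | insert b => simp [indelCosts]

/-- `dLCS ≤ 2·editDist`: the LCS cost assignment is at most twice the unit one termwise
(`1/1/0/2 ≤ 2·(1/1/0/1)`; a substitution is traded for a deletion and an insertion).
[cite: WagnerFischer1974, §5 with Theorem 1 (immediate consequence: termwise comparison of the two cost assignments)] -/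
theorem dLCS_le_two_mul_editDist (x y : List α) : dLCS x y ≤ 2 * editDist x y := by
  rw [← lev_unitCosts, ← lev_indelCosts]
  refine lev_le_mul_lev (fun p => ?_) x y
  cases p with
  | subst a b => by_cases h : a = b <;> simp [indelCosts, h]
  | delete a => simp [indelCosts]
  | insert b => simp [indelCosts]

end Subsequence

end Literature.Computability.StringMatching
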